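import Literature.NumberTheory.EllipticCurves.Rank1Residual.Typed.Basic
import Literature.NumberTheory.EllipticCurves.Rank1Residual.Predicates
import HarnessLib

/-!
# Route ByReductionTypeAtTwo — the good-ordinary-at-`2` DESCENT-INEQUALITY statement as a CLOSED `Prop`
# leaf in a standalone Theorems module (importable by route files; no route file, no `Summits.…X5` import)

Why this file exists (seat bsd-2adic-ord-3 GEN 2, 2026-08-26; planner bsd-2adic-plan GEN 13 rider K-6,
plan/routes/NEXT-ROUND.md ADDENDUM 2): the seat's kernel files
`Theorems/ByReductionTypeAtTwoOrdEisensteinHalfSha{Algebra,Dictionary,Currency,Crux,Isogeny}.lean` show that on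
the formula route's domain (non-CM, analytic rank `0`, good ordinary at `2`) the Eisenstein crux
`OrdEisensteinHalfAtTwo` carries, beyond its sibling `OrdKatoHalfAtTwo`, exactly ONE isogeny-invariant
descent inequality per curve: Miller's lower half `MissingLowerBoundAt W 2` (`ord₂ #Ш_an(E) ≤ ord₂ #Ш(E)[2^∞]`).
The planner re-splits the parent `GoodOrdinaryRankZeroAtTwo ⟸ OrdPublishedInputsAtTwo ∧ OrdKatoHalfAtTwo ∧
OrdMissingLowerBoundAtTwo`; this module states the third child VERBATIM as a closed `Prop` so the route item
can alias it (pattern of `ByReductionTypeAtTwoOrdHalvesDefs.lean`). Nothing asserted; an `Iff.rfl` lemma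
records the unfolding. The ∀-closed glue is `Theorems/ByReductionTypeAtTwoGoodOrdinaryRankZeroOfMissingLowerBound.lean`.

Certificate status of record (EVIDENCE tier, not used here): kit j251284 / j251635 (PARI 2.17.2 `ellrank`
2-descent + Cassels–Tate on 2-coverings, rank `0` by Gross–Zagier–Kolyvagin) certify the inequality on
574 of the 609 rank-`0` good-ordinary X5 classes (CENSUS-19272.md on item stmt-BirchSwinnertonDyer-19272).
-/

set_option autoImplicit false

namespace Summit.BirchSwinnertonDyer.BirchSwinnertonDyer.Theorems.OrdHalvesAtTwo

/-- [support/crux child] **The DESCENT INEQUALITY on the class «non-CM, analytic rank 0, good ordinary at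
2»:** for every such globally minimal `W`, `ord₂ #Ш_an(W) ≤ ord₂ #Ш(W)` in Miller's currency
(`Literature.NumberTheory.EllipticCurves.Rank1Residual.Typed.MissingLowerBoundAt W 2`: `#Ш_an = q ∈ ℚ` with
`ord₂ q ≤ ord₂ #Ш`). Per curve this is a finite 2-power descent statement (exhibit `2^{ord₂ #Ш_an}`
elements of `Ш[2^∞]`; at `ord₂ #Ш_an = 4`: `Sel₂(E/ℚ) = Ш[2] ≅ (ℤ/2)²` with trivial Cassels–Tate pairing),
an ISOGENY INVARIANT (`EisensteinShaCurrency.missingLowerBoundAt_of_isIsogenous`), and class-wide it is the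
lower half of `BSD(E,2)` — OPEN as a ∀-statement; nothing asserted. With `OrdPublishedInputsAtTwo` and
`OrdKatoHalfAtTwo` it gives the parent `GoodOrdinaryRankZeroAtTwo`
(`goodOrdinaryRankZeroAtTwo_of_katoHalf_of_missingLowerBound`) and is EQUIVALENT, granted those two, to the
rank-`0` part of `OrdEisensteinHalfAtTwo`
(`EisensteinShaCurrency.eisenstein_rankZero_iff_missingLowerBoundAt_rankZero_of_ordKatoHalfAtTwo`).
[cite: Miller2011LMS, Def. 1.1 (arXiv:1010.2431 p. 3) (currency; the class-wide statement is not in print at p = 2)] -/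
@[conjecture] def OrdMissingLowerBoundAtTwo : Prop :=
  ∀ (W : WeierstrassCurve ℚ) [W.IsElliptic] [W.IsGloballyMinimal], ¬ W.HasCM → W.analyticRank = 0 →
    Literature.NumberTheory.EllipticCurves.Rank1Residual.GoodOrd W 2 →
    Literature.NumberTheory.EllipticCurves.Rank1Residual.Typed.MissingLowerBoundAt W 2

/-- Bookkeeping: the descent-inequality child unfolds to its text. [folklore] -/
theorem ordMissingLowerBoundAtTwo_iff : OrdMissingLowerBoundAtTwo ↔
    ∀ (W : WeierstrassCurve ℚ) [W.IsElliptic] [W.IsGloballyMinimal], ¬ W.HasCM → W.analyticRank = 0 →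
      Literature.NumberTheory.EllipticCurves.Rank1Residual.GoodOrd W 2 →
      Literature.NumberTheory.EllipticCurves.Rank1Residual.Typed.MissingLowerBoundAt W 2 :=
  Iff.rfl

end Summit.BirchSwinnertonDyer.BirchSwinnertonDyer.Theorems.OrdHalvesAtTwo
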